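import Summits.QuantumFields.YangMills.Theorems.LuscherReductionTwistedTraceScalingBOCapProfile
import Summits.QuantumFields.YangMills.Theorems.LuscherReductionTwistedTraceScalingBTFibreProfile
import Summits.QuantumFields.YangMills.Theorems.LuscherReductionTwistedTraceScalingSlowDisintegrationTubes
import Summits.QuantumFields.YangMills.Theorems.FlatTubeReductionCoreDefectWindowMoments
import HarnessLib

/-!
# The output fibre weight of the core `L²` estimate is dominated by the record profile

Support file for the crux `NearFlatRatioLaw` (line `ratepack_v2`, stub `stub_hODpot_A`, step (R3e) of
`Cruxes/NearFlatRatioLaw/Lines/ratepack-v7-moments-g18.md` §11).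

The fibre integral of `…CoreDefectRecordOrbitMoments.defect_core_sq_record_orbit_moments` carries the output weight
`w(v) = 𝟙{‖x_v‖ ≤ R_in}·e^{-q(x_v)}·e^{-‖P_Γ x_v‖²/δg²}`, while `…FibreFactorReferenceMass.fibre_factor_le_reference_mass` wants a colour-rotation
invariant weight `0 ≤ Ω₁ ≤ Ω_rec = 𝟙_cap·frozenProfile q r β` on the link space.  With
`Ω₁ = 𝟙_cap · 𝟙{‖x‖ ≤ R_in} · e^{-q} · e^{-‖P_Γ·‖²/δg²}` (`capInnerWeight`, written inline): `Ω₁ ≤ Ω_rec` pointwise for `R_in ≤ r β`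
(the freezing cutoff of `frozenProfile` is `1` on the closed ball of radius `r β`, which also carries the gauge-mode Gaussian), `Ω₁` is
colour-rotation invariant and measurable, and `Ω₁(x_v) = w(v)` for `π`-almost every `v` (the transverse measure lives on the capped
balanced set, `orthoTransverse_compl_capBalancedSet`), so fibre integrals against `w` and against `Ω₁ ∘ linkEmbed` agree.
-/

noncomputable section

open MeasureTheory Filter Topology Real
open scoped BigOperators
open Literature.MathematicalPhysics.QuantumFieldTheory
open Literature.MathematicalPhysics.QuantumLattice

namespace Summit.QuantumFields.YangMills.Theorems.FemtoTransferGap.TwoLattice.ConstTube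

open Summit.QuantumFields.YangMills.Theorems.FemtoTransferGap
open Summit.QuantumFields.YangMills.Theorems.FemtoTransferGap.TwoLattice
open Summit.QuantumFields.YangMills.Theorems.FemtoTransferGap.TwoLattice.Avg
open Summit.QuantumFields.YangMills.Theorems.FemtoTransferGap.TwoLattice.Stiff
open Summit.QuantumFields.YangMills.Theorems.FemtoTransferGap.TwoLattice.GnChart

variable {L : ℕ} [NeZero L]

/-- ★ **Domination**: `𝟙_cap(x)·𝟙{‖x‖ ≤ R_in}·e^{-q_β(x)}·e^{-‖P_Γx‖²/δg²} ≤ 𝟙_cap(x)·frozenProfile q r β x` for `R_in ≤ r β` (any `q`). [folklore] -/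
theorem capInnerWeight_le_capRestrict (q : ℝ → LinkSpace L → ℝ) (r : ℝ → ℝ) (β : ℝ) {Rin : ℝ} (hRin : Rin ≤ r β) (x : LinkSpace L) :
    {x : LinkSpace L | linkCurry x ∈ capBalancedSet L}.indicator (fun _ => (1 : ℝ)) x *
        ({x : LinkSpace L | ‖x‖ ≤ Rin}.indicator (fun _ => (1 : ℝ)) x * (Real.exp (-(q β x)) * Real.exp (-(‖(gaugeModes L).starProjection x‖ ^ 2 / powScale 1 β ^ 2)))) ≤
      {x : LinkSpace L | linkCurry x ∈ capBalancedSet L}.indicator (fun _ => (1 : ℝ)) x * frozenProfile L q r β x := by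
  refine mul_le_mul_of_nonneg_left ?_ (Set.indicator_nonneg (fun _ _ => zero_le_one) _)
  unfold frozenProfile
  by_cases hx : x ∈ {x : LinkSpace L | ‖x‖ ≤ Rin}
  · have hball : x ∈ Metric.closedBall (0 : LinkSpace L) (r β) := by
      rw [Metric.mem_closedBall, dist_zero_right]; exact (show ‖x‖ ≤ Rin from hx).trans hRin
    rw [Set.indicator_of_mem hx, Set.indicator_of_mem hball, one_mul, mul_one, mul_comm]
  · rw [Set.indicator_of_notMem hx, zero_mul]
    exact mul_nonneg (mul_nonneg (Real.exp_nonneg _) (Real.exp_nonneg _)) (Set.indicator_nonneg (fun _ _ => zero_le_one) _)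

/-- ★ **Invariance** of the capped inner weight under the global colour rotation (for a colour-blind `q β`). [folklore] -/
theorem capInnerWeight_adL {q : ℝ → LinkSpace L → ℝ} {β : ℝ} (hqinv : ∀ (g : SU2) (x : LinkSpace L), q β (adL L g x) = q β x) (Rin : ℝ) (g : SU2) (x : LinkSpace L) :
    {x : LinkSpace L | linkCurry x ∈ capBalancedSet L}.indicator (fun _ => (1 : ℝ)) (adL L g x) *
        ({x : LinkSpace L | ‖x‖ ≤ Rin}.indicator (fun _ => (1 : ℝ)) (adL L g x) *
          (Real.exp (-(q β (adL L g x))) * Real.exp (-(‖(gaugeModes L).starProjection (adL L g x)‖ ^ 2 / powScale 1 β ^ 2)))) =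
      {x : LinkSpace L | linkCurry x ∈ capBalancedSet L}.indicator (fun _ => (1 : ℝ)) x *
        ({x : LinkSpace L | ‖x‖ ≤ Rin}.indicator (fun _ => (1 : ℝ)) x * (Real.exp (-(q β x)) * Real.exp (-(‖(gaugeModes L).starProjection x‖ ^ 2 / powScale 1 β ^ 2)))) := by
  have hinner : ∀ (g' : SU2) (y : LinkSpace L), {x : LinkSpace L | ‖x‖ ≤ Rin}.indicator (fun _ => (1 : ℝ)) (adL L g' y) *
      (Real.exp (-(q β (adL L g' y))) * Real.exp (-(‖(gaugeModes L).starProjection (adL L g' y)‖ ^ 2 / powScale 1 β ^ 2))) =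
      {x : LinkSpace L | ‖x‖ ≤ Rin}.indicator (fun _ => (1 : ℝ)) y * (Real.exp (-(q β y)) * Real.exp (-(‖(gaugeModes L).starProjection y‖ ^ 2 / powScale 1 β ^ 2))) := by
    intro g' y
    rw [hqinv, starProjection_adL, LinearIsometryEquiv.norm_map]
    have hmem : adL L g' y ∈ {x : LinkSpace L | ‖x‖ ≤ Rin} ↔ y ∈ {x : LinkSpace L | ‖x‖ ≤ Rin} := by
      simp only [Set.mem_setOf_eq, LinearIsometryEquiv.norm_map]
    by_cases hy : y ∈ {x : LinkSpace L | ‖x‖ ≤ Rin}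
    · rw [Set.indicator_of_mem hy, Set.indicator_of_mem (hmem.mpr hy)]
    · rw [Set.indicator_of_notMem hy, Set.indicator_of_notMem (fun h => hy (hmem.mp h))]
  exact capRestrict_adL (L := L) (Ω := fun y => {x : LinkSpace L | ‖x‖ ≤ Rin}.indicator (fun _ => (1 : ℝ)) y *
    (Real.exp (-(q β y)) * Real.exp (-(‖(gaugeModes L).starProjection y‖ ^ 2 / powScale 1 β ^ 2)))) hinner g x

/-- The capped inner weight is measurable (for measurable `q β`). [folklore] -/
theorem measurable_capInnerWeight {q : ℝ → LinkSpace L → ℝ} {β : ℝ} (hqm : Measurable (q β)) (Rin : ℝ) :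
    Measurable (fun x : LinkSpace L => {x : LinkSpace L | linkCurry x ∈ capBalancedSet L}.indicator (fun _ => (1 : ℝ)) x *
      ({x : LinkSpace L | ‖x‖ ≤ Rin}.indicator (fun _ => (1 : ℝ)) x * (Real.exp (-(q β x)) * Real.exp (-(‖(gaugeModes L).starProjection x‖ ^ 2 / powScale 1 β ^ 2)))) ) :=
  (measurable_const.indicator (measurableSet_capLink (L := L))).mul
    ((measurable_const.indicator (measurableSet_le measurable_norm measurable_const)).mul
      (hqm.neg.exp.mul (((gaugeModes L).starProjection.continuous.measurable.norm.pow_const 2).div_const _).neg.exp))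

/-- ★ **Almost-sure agreement**: against the transverse fibre measure the capped inner weight at `x_v` is the output weight `w(v)` of the core
`L²` estimate — `π`-a.e. `v` is capped-balanced. [folklore] -/
theorem capInnerWeight_ae_eq (q : ℝ → LinkSpace L → ℝ) (β Rin : ℝ) :
    ∀ᵐ v ∂orthoTransverse L,
      {x : LinkSpace L | linkCurry x ∈ capBalancedSet L}.indicator (fun _ => (1 : ℝ)) (linkEmbed L v) *
          ({x : LinkSpace L | ‖x‖ ≤ Rin}.indicator (fun _ => (1 : ℝ)) (linkEmbed L v) *
            (Real.exp (-(q β (linkEmbed L v))) * Real.exp (-(‖(gaugeModes L).starProjection (linkEmbed L v)‖ ^ 2 / powScale 1 β ^ 2)))) =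
        {v : Edge 3 L → Fin 3 → ℝ | ‖linkEmbed L v‖ ≤ Rin}.indicator (fun _ => (1 : ℝ)) v *
          (Real.exp (-(q β (linkEmbed L v))) * Real.exp (-(‖(gaugeModes L).starProjection (linkEmbed L v)‖ ^ 2 / powScale 1 β ^ 2))) := by
  have hae : ∀ᵐ v ∂orthoTransverse L, v ∈ capBalancedSet L := by rw [ae_iff]; exact orthoTransverse_compl_capBalancedSet L
  filter_upwards [hae] with v hv
  have hcap : linkEmbed L v ∈ {x : LinkSpace L | linkCurry x ∈ capBalancedSet L} := by
    show linkCurry (linkEmbed L v) ∈ capBalancedSet L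
    have e : linkCurry (linkEmbed L v) = v := by funext e a; rfl
    rw [e]; exact hv
  rw [Set.indicator_of_mem hcap, one_mul]
  have hmem : linkEmbed L v ∈ {x : LinkSpace L | ‖x‖ ≤ Rin} ↔ v ∈ {v : Edge 3 L → Fin 3 → ℝ | ‖linkEmbed L v‖ ≤ Rin} := Iff.rfl
  by_cases h : v ∈ {v : Edge 3 L → Fin 3 → ℝ | ‖linkEmbed L v‖ ≤ Rin}
  · rw [Set.indicator_of_mem h, Set.indicator_of_mem (hmem.mpr h)]
  · rw [Set.indicator_of_notMem h, Set.indicator_of_notMem (fun h' => h (hmem.mp h'))]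

/-- ★★ **Consequence**: any fibre integral against the output weight `w` equals the one against `Ω₁ ∘ linkEmbed`. [folklore] -/
theorem integral_outputWeight_eq_capInnerWeight (q : ℝ → LinkSpace L → ℝ) (β Rin : ℝ) (X : (Edge 3 L → Fin 3 → ℝ) → ℝ) :
    ∫ v, {v : Edge 3 L → Fin 3 → ℝ | ‖linkEmbed L v‖ ≤ Rin}.indicator (fun _ => (1 : ℝ)) v *
        (Real.exp (-(q β (linkEmbed L v))) * Real.exp (-(‖(gaugeModes L).starProjection (linkEmbed L v)‖ ^ 2 / powScale 1 β ^ 2))) * X v ∂orthoTransverse L =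
      ∫ v, {x : LinkSpace L | linkCurry x ∈ capBalancedSet L}.indicator (fun _ => (1 : ℝ)) (linkEmbed L v) *
          ({x : LinkSpace L | ‖x‖ ≤ Rin}.indicator (fun _ => (1 : ℝ)) (linkEmbed L v) *
            (Real.exp (-(q β (linkEmbed L v))) * Real.exp (-(‖(gaugeModes L).starProjection (linkEmbed L v)‖ ^ 2 / powScale 1 β ^ 2)))) * X v ∂orthoTransverse L := by
  refine integral_congr_ae ?_
  filter_upwards [capInnerWeight_ae_eq (L := L) q β Rin] with v hv
  rw [hv]

end Summit.QuantumFields.YangMills.Theorems.FemtoTransferGap.TwoLattice.ConstTube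

end
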